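import Mathlib
import HarnessLib
import Literature.Analysis.FluidPDE.Tao2016AveragedNS.TaylorChainCertificate
import Summits.NavierStokesRegularity.NavierStokesRegularity.Theorems.TaylorModelRungThreeReadoutFlow

/-!
# Line `taylor-model` on crux K1b-DR (stmt-NavierStokesRegularity-23954) — stub G0i, part 2:
# jet identification, (F4) segment derivatives and (F5) Taylor-model bounds at the certificate's centres

Continuation of `…TaylorModelRungThreeReadoutFlow`. For a window flow `Φ` with S1's conclusions at stage `j`
(`WindowPack cd j Φ`) and its lift `liftFlow cd Φ`:

* JET IDENTIFICATION — a jet table obeying the certificate's Cauchy-product recursion in cascade coordinates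
  is, read in window coordinates, the global jet of the transported field: `toVec_table_eq_taylorJet`,
  `toVec_varTable_eq_varJet` (recursion uniqueness, helper 0a), hence the certificate polynomials `TP`, `Vap`
  are the Taylor polynomials of S1 (`toVec_TP`, `toVec_Vap`);
* (F4) `liftFlow_segment_deriv` — derivative of `σ ↦ φ (z' + σ(z − z')) i k t'` along a segment in the
  `ρ`-box, with the variational majorant bound `(1 − bb (m+ρ) t')⁻² · dd · ω j k` (S1's Fréchet derivative
  composed with the affine segment, `HasFDerivAt.comp_hasDerivAt`, then the component);
* (F5) `liftFlow_TP_bound` (Taylor remainder `Rem`), `liftFlow_Vap_bound` (variation remainder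
  `Dev + RemV·ρ'`), `liftFlow_twoPoint_bound` (two-point form along a segment by the mean value inequality
  `norm_image_sub_le_of_norm_deriv_le_segment'` with S1's derivative-remainder bound).

MODEL-lattice bookkeeping only (rung TL-M3); nothing here is a statement about the Navier–Stokes equations.
-/

noncomputable section

-- the sub-problem namespace repeats the summit name by design (D-0017)
set_option linter.dupNamespace false

namespace Summit.NavierStokesRegularity.NavierStokesRegularity.Theorems.TaylorModelReadout

open scoped BigOperators
open Set Finset Literature.Analysis.FluidPDE.TaoCascade Literature.Analysis.FluidPDE.TaoCascade.TaylorChain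
open Summit.NavierStokesRegularity.NavierStokesRegularity.Theorems.TaylorModel

variable {cd : CertData}

/-! ### Jet identification -/

/-- `Qw` of restrictions is the restriction of `Qb`. [folklore] -/
theorem Qw_toVec (a b : Fin 4 → ℤ → ℝ) : Qw cd (toVec cd a) (toVec cd b) = toVec cd (cd.Qb a b) := by
  rw [Qw, ofVec_toVec, ofVec_toVec, Qb_trunc]

/-- A cascade-coordinate table obeying the Taylor recursion with `cd.Qb` below degree `p` reads, in window
coordinates, as the global Taylor jets of `Qw cd`. [folklore] -/
theorem toVec_table_eq_taylorJet {x : Fin 4 → ℤ → ℝ} {P : ℕ → Fin 4 → ℤ → ℝ} {p : ℕ} (h0 : P 0 = x)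
    (hrec : ∀ n, n < p → ∀ i k, ((n : ℝ) + 1) * P (n + 1) i k =
      ∑ m' ∈ Finset.range (n + 1), cd.Qb (P m') (P (n - m')) i k) :
    ∀ n, n ≤ p → toVec cd (P n) = taylorJet (Qw cd) (toVec cd x) n := by
  refine eq_taylorJet_of_rec (Qw cd) (toVec cd x) (P := fun n => toVec cd (P n)) (by rw [h0]) ?_
  intro n hn
  funext c
  rw [Pi.smul_apply, smul_eq_mul, Finset.sum_apply]
  simp only [toVec, Qw_toVec]
  exact hrec n hn _ _

/-- A cascade-coordinate table obeying the variational recursion with `cd.Qb` (around a Taylor table) below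
degree `p`, starting from the truncation of `v`, reads in window coordinates as the global variational jets.
[folklore] -/
theorem toVec_varTable_eq_varJet {x v : Fin 4 → ℤ → ℝ} {P : ℕ → Fin 4 → ℤ → ℝ} {W : ℕ → Fin 4 → ℤ → ℝ}
    {p : ℕ} (hP : ∀ n, n ≤ p → toVec cd (P n) = taylorJet (Qw cd) (toVec cd x) n)
    (h0 : ∀ i k, W 0 i k = if -cd.Kb ≤ k ∧ k ≤ cd.Ka then v i k else 0)
    (hrec : ∀ n, n < p → ∀ i k, ((n : ℝ) + 1) * W (n + 1) i k =
      ∑ m' ∈ Finset.range (n + 1), (cd.Qb (P m') (W (n - m')) i k + cd.Qb (W (n - m')) (P m') i k)) :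
    ∀ n, n ≤ p → toVec cd (W n) = varJet (Qw cd) (toVec cd x) (toVec cd v) n := by
  refine eq_varJet_of_rec (Qw cd) (toVec cd x) (toVec cd v) (W := fun n => toVec cd (W n)) ?_ ?_
  · funext c
    simp only [toVec, h0, shellOf_mem cd c, and_self, ↓reduceIte]
  · intro n hn
    funext c
    rw [Pi.smul_apply, smul_eq_mul, Finset.sum_apply]
    have hm : ∀ m' ∈ Finset.range (n + 1), toVec cd (P m') = taylorJet (Qw cd) (toVec cd x) m' :=
      fun m' hm' => hP m' ((Nat.lt_succ_iff.1 (Finset.mem_range.1 hm')).trans hn.le)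
    rw [show ((n : ℝ) + 1) * toVec cd (W (n + 1)) c = ((n : ℝ) + 1) * W (n + 1) (modeOf cd c) (shellOf cd c)
      from rfl, hrec n hn]
    refine Finset.sum_congr rfl fun m' hm' => ?_
    rw [Pi.add_apply, ← hm m' hm', Qw_toVec, Qw_toVec]
    rfl

/-- The certificate's Taylor polynomial `TP j s u`, in window coordinates, is S1's Taylor polynomial of the
jets at the centre. [folklore] -/
theorem toVec_TP {j s : ℕ} (hP : ∀ n, n ≤ cd.pdeg → toVec cd (cd.P j s n) = taylorJet (Qw cd) (toVec cd (cd.x j s)) n)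
    (u : ℝ) (c : Fin (nW cd)) :
    toVec cd (cd.TP j s u) c =
      ∑ n ∈ Finset.range (cd.pdeg + 1), taylorJet (Qw cd) (toVec cd (cd.x j s)) n c * u ^ n := by
  simp only [toVec, CertData.TP]
  refine Finset.sum_congr rfl fun n hn => ?_
  have h := congrFun (hP n (Nat.lt_succ_iff.1 (Finset.mem_range.1 hn))) c
  simp only [toVec] at h
  rw [h]

/-- The certificate's variational polynomial `Vap j s u v`, in window coordinates, is S1's variational Taylor
polynomial at the centre. [folklore] -/
theorem toVec_Vap {j s : ℕ} {v : Fin 4 → ℤ → ℝ}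
    (hW : ∀ n, n ≤ cd.pdeg → toVec cd (cd.Wv j s n v) = varJet (Qw cd) (toVec cd (cd.x j s)) (toVec cd v) n)
    (u : ℝ) (c : Fin (nW cd)) :
    toVec cd (cd.Vap j s u v) c =
      ∑ n ∈ Finset.range (cd.pdeg + 1), varJet (Qw cd) (toVec cd (cd.x j s)) (toVec cd v) n c * u ^ n := by
  simp only [toVec, CertData.Vap]
  refine Finset.sum_congr rfl fun n hn => ?_
  have h := congrFun (hW n (Nat.lt_succ_iff.1 (Finset.mem_range.1 hn))) c
  simp only [toVec] at h
  rw [h]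

/-! ### (F4) segment derivatives -/

section Pack

variable {Φ : (Fin (nW cd) → ℝ) → ℝ → Fin (nW cd) → ℝ} {j : ℕ} (hP : WindowPack cd j Φ)
  (hω : ∀ k, 0 < cd.ω j k) (hbb : 0 ≤ cd.bb j)
include hP hω hbb

/-- From the two-radius guard `bb (m+ρ) T < 1` to the one-radius guard `bb m T < 1`. [folklore] -/
theorem guard_mono {m ρ T : ℝ} (hρ : 0 ≤ ρ) (hT : 0 ≤ T) (hg : cd.bb j * (m + ρ) * T < 1) :
    cd.bb j * m * T < 1 := by
  have := hP
  have := hω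
  have hb : 0 ≤ cd.bb j * T := mul_nonneg hbb hT
  nlinarith

/-- **(F4)** Along a segment inside the `ρ`-box around `x`, the map `σ ↦ φ (z' + σ(z − z')) i k t'` is
differentiable with derivative bounded by `(1 − bb (m+ρ) t')⁻² · dd · ω j k`, `dd` the weighted distance of
the endpoints. [folklore] -/
theorem liftFlow_segment_deriv {x : Fin 4 → ℤ → ℝ} {m ρ T : ℝ} (hm : 0 ≤ m) (hρ : 0 ≤ ρ)
    (hx : cd.InBall j x m) (hT : 0 ≤ T) (hg : cd.bb j * (m + ρ) * T < 1) {z z' : Fin 4 → ℤ → ℝ} {dd : ℝ}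
    (hz : cd.InBall j (z - x) ρ) (hz' : cd.InBall j (z' - x) ρ) (hzz : cd.InBall j (z - z') dd)
    (i : Fin 4) {k : ℤ} (hk1 : -cd.Kb ≤ k) (hk2 : k ≤ cd.Ka) {t' : ℝ} (ht' : t' ∈ Icc 0 T) :
    ∃ ψ : ℝ → ℝ, ∀ σ ∈ Icc (0:ℝ) 1,
      HasDerivWithinAt (fun σ' : ℝ => liftFlow cd Φ (z' + σ' • (z - z')) i k t') (ψ σ) (Icc 0 1) σ ∧
      |ψ σ| ≤ (1 / (1 - cd.bb j * (m + ρ) * t') ^ 2) * dd * cd.ω j k := by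
  have hk : -cd.Kb ≤ k ∧ k ≤ cd.Ka := ⟨hk1, hk2⟩
  set c : Fin (nW cd) := eW cd (i, ⟨k, Finset.mem_Icc.2 hk⟩) with hc
  have hdd : 0 ≤ dd := by
    have h := hzz i k hk1 hk2
    have hωk := hω k
    nlinarith [abs_nonneg ((z - z') i k)]
  -- the point `z' + σ (z - z')` is `x + v_σ` with `v_σ` in the `ρ`-box
  have hvσ : ∀ σ ∈ Icc (0:ℝ) 1, cd.InBall j (z' + σ • (z - z') - x) ρ := by
    intro σ hσ i' k' h1 h2
    have e : (z' + σ • (z - z') - x) i' k' = (1 - σ) * (z' - x) i' k' + σ * (z - x) i' k' := by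
      simp only [Pi.add_apply, Pi.sub_apply, Pi.smul_apply, smul_eq_mul]; ring
    rw [e]
    have a1 := hz' i' k' h1 h2
    have a2 := hz i' k' h1 h2
    have hs0 : 0 ≤ σ := hσ.1
    have hs1 : 0 ≤ 1 - σ := by linarith [hσ.2]
    calc |(1 - σ) * (z' - x) i' k' + σ * (z - x) i' k'|
        ≤ |(1 - σ) * (z' - x) i' k'| + |σ * (z - x) i' k'| := abs_add_le _ _
      _ = (1 - σ) * |(z' - x) i' k'| + σ * |(z - x) i' k'| := by
          rw [abs_mul, abs_mul, abs_of_nonneg hs1, abs_of_nonneg hs0]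
      _ ≤ (1 - σ) * (ρ * cd.ω j k') + σ * (ρ * cd.ω j k') := by gcongr
      _ = ρ * cd.ω j k' := by ring
  have hmT : cd.bb j * m * T < 1 := guard_mono hP hω hbb hρ hT hg
  have hxw : ∀ c', |toVec cd x c'| ≤ m * wW cd j c' := (inBall_iff_toVec cd j x m).1 hx
  have key := (hP.2.2 (toVec cd x) m T hm hxw hT hmT).2.2.2.2
  -- the derivative package at every point of the segment
  have hL : ∀ σ ∈ Icc (0:ℝ) 1, ∃ L : (Fin (nW cd) → ℝ) →L[ℝ] (Fin (nW cd) → ℝ),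
      HasFDerivAt (fun y => Φ y t') L (toVec cd x + toVec cd (z' + σ • (z - z') - x)) ∧
      (∀ (w : Fin (nW cd) → ℝ) (ζ : ℝ), 0 ≤ ζ → (∀ c', |w c'| ≤ ζ * wW cd j c') →
        ∀ c', |L w c'| ≤ ζ / (1 - cd.bb j * (m + ρ) * t') ^ 2 * wW cd j c') := by
    intro σ hσ
    have hv := (inBall_iff_toVec cd j _ ρ).1 (hvσ σ hσ)
    obtain ⟨L, hL1, hL2, -⟩ := (key (toVec cd (z' + σ • (z - z') - x)) ρ hρ hv hg).2.2.2 t' ht'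
    exact ⟨L, hL1, hL2⟩
  refine ⟨fun σ => if h : σ ∈ Icc (0:ℝ) 1 then (Classical.choose (hL σ h)) (toVec cd (z - z')) c else 0,
    fun σ hσ => ?_⟩
  obtain ⟨hF, hB⟩ := Classical.choose_spec (hL σ hσ)
  set L := Classical.choose (hL σ hσ) with hLdef
  simp only [dif_pos hσ]
  constructor
  · -- chain rule along the affine segment, then the component `c`
    have hpt : toVec cd x + toVec cd (z' + σ • (z - z') - x) = toVec cd z' + σ • toVec cd (z - z') := by
      simp only [toVec_add, toVec_sub, toVec_smul]; abel
    rw [hpt] at hF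
    have hg' : HasDerivAt (fun σ' : ℝ => toVec cd z' + σ' • toVec cd (z - z')) (toVec cd (z - z')) σ := by
      simpa using ((hasDerivAt_id σ).smul_const (toVec cd (z - z'))).const_add (toVec cd z')
    have hcomp := hF.comp_hasDerivAt σ hg'
    have hcomp' : HasDerivAt (fun σ' : ℝ => Φ (toVec cd z' + σ' • toVec cd (z - z')) t' c)
        (L (toVec cd (z - z')) c) σ := (hasDerivAt_pi.1 hcomp) c
    have hfun : (fun σ' : ℝ => liftFlow cd Φ (z' + σ' • (z - z')) i k t') =
        fun σ' : ℝ => Φ (toVec cd z' + σ' • toVec cd (z - z')) t' c := by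
      funext σ'
      rw [liftFlow_of_mem _ i hk, hc]
      simp only [toVec_add, toVec_smul]
    rw [hfun]
    exact hcomp'.hasDerivWithinAt
  · have hw : ∀ c', |toVec cd (z - z') c'| ≤ dd * wW cd j c' := (inBall_iff_toVec cd j _ dd).1 hzz
    have h := hB (toVec cd (z - z')) dd hdd hw c
    have hwc : wW cd j c = cd.ω j k := by simp [wW, hc, shellOf]
    rw [hwc] at h
    calc |L (toVec cd (z - z')) c| ≤ dd / (1 - cd.bb j * (m + ρ) * t') ^ 2 * cd.ω j k := h
      _ = 1 / (1 - cd.bb j * (m + ρ) * t') ^ 2 * dd * cd.ω j k := by ring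

/-! ### (F5) Taylor-model bounds at a certificate centre -/

omit hω hbb in
/-- **(F5a)** The Taylor remainder of the centre trajectory relative to the certificate polynomial `TP`:
`|φ(x s, u) − TP s u| ≤ Rem(bb, mC, u)` componentwise in the weighted norm, for `u ∈ [0, h]`, given the
centre's M-bound `mC`, the guard `bb·mC·h < 1`, and that the certificate's jets `P` obey the recursion.
[folklore] -/
theorem liftFlow_TP_bound {s : ℕ} (hmC : 0 ≤ cd.mC j s) (hxm : cd.InBall j (cd.x j s) (cd.mC j s))
    (hh : 0 ≤ cd.h j s) (hgd : cd.bb j * cd.mC j s * cd.h j s < 1)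
    (hPj : ∀ n, n ≤ cd.pdeg → toVec cd (cd.P j s n) = taylorJet (Qw cd) (toVec cd (cd.x j s)) n)
    {u : ℝ} (hu : u ∈ Icc 0 (cd.h j s)) :
    cd.InBall j (stAt (fun _ => liftFlow cd Φ) j (cd.x j s) u - cd.TP j s u) (cd.Rem (cd.bb j) (cd.mC j s) u) := by
  have hxw := (inBall_iff_toVec cd j _ _).1 hxm
  have key := (hP.2.2 (toVec cd (cd.x j s)) (cd.mC j s) (cd.h j s) hmC hxw hh hgd).2.2.2.1 u hu cd.pdeg
  rw [inBall_iff_toVec]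
  intro c
  have h := key c
  rw [toVec_sub, stAt_liftFlow, toVec_ofVec, Pi.sub_apply, toVec_TP hPj u c]
  simpa [CertData.Rem] using h

/-- From `ρ' ≤ ρO` and the guard at `ρO` to the guard at `ρ'`. [folklore] -/
theorem guard_of_le {m ρ' ρO hh : ℝ} (hle : ρ' ≤ ρO) (hh0 : 0 ≤ hh) (hg : cd.bb j * (m + ρO) * hh < 1) :
    cd.bb j * (m + ρ') * hh < 1 := by
  have := hP
  have := hω
  have hb : 0 ≤ cd.bb j * hh := mul_nonneg hbb hh0
  nlinarith

/-- **(F5b)** The variation remainder relative to the certificate's variational polynomial `Vap`: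
`|φ(x s + v, u) − φ(x s, u) − Vap s u v| ≤ Dev(bb, mC, ρ', u) + RemV(bb, mC, u)·ρ'` for window-supported `v`
with `|v| ≤ ρ' ≤ ρO`, given the guard `bb·(mC + ρO)·h < 1` and the jet identifications. [folklore] -/
theorem liftFlow_Vap_bound {s : ℕ} (hmC : 0 ≤ cd.mC j s) (hxm : cd.InBall j (cd.x j s) (cd.mC j s))
    (hh : 0 ≤ cd.h j s) (hgO : cd.bb j * (cd.mC j s + cd.ρO j s) * cd.h j s < 1)
    (hWj : ∀ (v : Fin 4 → ℤ → ℝ) n, n ≤ cd.pdeg →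
      toVec cd (cd.Wv j s n v) = varJet (Qw cd) (toVec cd (cd.x j s)) (toVec cd v) n)
    {v : Fin 4 → ℤ → ℝ} {ρ' : ℝ} (hρ' : 0 ≤ ρ') (hle : ρ' ≤ cd.ρO j s) (hv : cd.InBall j v ρ')
    {u : ℝ} (hu : u ∈ Icc 0 (cd.h j s)) :
    cd.InBall j (stAt (fun _ => liftFlow cd Φ) j (cd.x j s + v) u - stAt (fun _ => liftFlow cd Φ) j (cd.x j s) u
        - cd.Vap j s u v)
      (CertData.Dev (cd.bb j) (cd.mC j s) ρ' u + cd.RemV (cd.bb j) (cd.mC j s) u * ρ') := by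
  have hxw := (inBall_iff_toVec cd j _ _).1 hxm
  have hg' : cd.bb j * (cd.mC j s + ρ') * cd.h j s < 1 := guard_of_le hP hω hbb hle hh hgO
  have hgd : cd.bb j * cd.mC j s * cd.h j s < 1 := guard_mono hP hω hbb hρ' hh hg'
  have key := ((hP.2.2 (toVec cd (cd.x j s)) (cd.mC j s) (cd.h j s) hmC hxw hh hgd).2.2.2.2
    (toVec cd v) ρ' hρ' ((inBall_iff_toVec cd j v ρ').1 hv) hg').2.2.1 u hu cd.pdeg
  rw [inBall_iff_toVec]
  intro c
  have h := key c
  rw [toVec_sub, toVec_sub, stAt_liftFlow, stAt_liftFlow, toVec_ofVec, toVec_ofVec, Pi.sub_apply, Pi.sub_apply,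
    toVec_Vap (hWj v) u c, toVec_add]
  refine h.trans (le_of_eq ?_)
  simp only [CertData.Dev, CertData.RemV]
  ring

/-- **(F5c)** Two-point form: for `y, y'` in the `ρO`-box around the centre with weighted distance `dd`,
`|φ(y,u) − φ(y',u) − Vap s u (y − y')| ≤ (RemV + [(1 − bb(mC+ρO)u)⁻² − (1 − bb·mC·u)⁻²])·dd` componentwise —
the mean value inequality along the segment with S1's derivative-remainder bound. [folklore] -/
theorem liftFlow_twoPoint_bound {s : ℕ} (hmC : 0 ≤ cd.mC j s) (hxm : cd.InBall j (cd.x j s) (cd.mC j s))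
    (hρO : 0 ≤ cd.ρO j s) (hh : 0 ≤ cd.h j s) (hgO : cd.bb j * (cd.mC j s + cd.ρO j s) * cd.h j s < 1)
    (hWj : ∀ (v : Fin 4 → ℤ → ℝ) n, n ≤ cd.pdeg →
      toVec cd (cd.Wv j s n v) = varJet (Qw cd) (toVec cd (cd.x j s)) (toVec cd v) n)
    {y y' : Fin 4 → ℤ → ℝ} {dd : ℝ} (hy : cd.InBall j (y - cd.x j s) (cd.ρO j s))
    (hy' : cd.InBall j (y' - cd.x j s) (cd.ρO j s)) (hyy : cd.InBall j (y - y') dd)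
    {u : ℝ} (hu : u ∈ Icc 0 (cd.h j s)) :
    cd.InBall j (stAt (fun _ => liftFlow cd Φ) j y u - stAt (fun _ => liftFlow cd Φ) j y' u - cd.Vap j s u (y - y'))
      ((cd.RemV (cd.bb j) (cd.mC j s) u +
        (1 / (1 - cd.bb j * (cd.mC j s + cd.ρO j s) * u) ^ 2 - 1 / (1 - cd.bb j * cd.mC j s * u) ^ 2)) * dd) := by
  set x := cd.x j s with hxdef
  set m := cd.mC j s with hmdef
  set ρ := cd.ρO j s with hρdef
  have hxw := (inBall_iff_toVec cd j _ _).1 hxm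
  have hgd : cd.bb j * m * cd.h j s < 1 := guard_mono hP hω hbb hρO hh hgO
  have key := (hP.2.2 (toVec cd x) m (cd.h j s) hmC hxw hh hgd).2.2.2.2
  -- nonnegativity of `dd` unless the window is empty (then the claim is vacuous)
  rw [inBall_iff_toVec]
  intro c
  have hk := shellOf_mem cd c
  have hdd : 0 ≤ dd := by
    have h := hyy (modeOf cd c) (shellOf cd c) hk.1 hk.2
    have hωk := hω (shellOf cd c)
    nlinarith [abs_nonneg ((y - y') (modeOf cd c) (shellOf cd c))]
  -- points of the segment are in the `ρ`-box
  have hvσ : ∀ σ ∈ Icc (0:ℝ) 1, cd.InBall j (y' + σ • (y - y') - x) ρ := by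
    intro σ hσ i' k' h1 h2
    have e : (y' + σ • (y - y') - x) i' k' = (1 - σ) * (y' - x) i' k' + σ * (y - x) i' k' := by
      simp only [Pi.add_apply, Pi.sub_apply, Pi.smul_apply, smul_eq_mul]; ring
    rw [e]
    have a1 := hy' i' k' h1 h2
    have a2 := hy i' k' h1 h2
    have hs0 : 0 ≤ σ := hσ.1
    have hs1 : 0 ≤ 1 - σ := by linarith [hσ.2]
    calc |(1 - σ) * (y' - x) i' k' + σ * (y - x) i' k'|
        ≤ |(1 - σ) * (y' - x) i' k'| + |σ * (y - x) i' k'| := abs_add_le _ _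
      _ = (1 - σ) * |(y' - x) i' k'| + σ * |(y - x) i' k'| := by
          rw [abs_mul, abs_mul, abs_of_nonneg hs1, abs_of_nonneg hs0]
      _ ≤ (1 - σ) * (ρ * cd.ω j k') + σ * (ρ * cd.ω j k') := by gcongr
      _ = ρ * cd.ω j k' := by ring
  -- the derivative data along the segment
  set B : ℝ := dd * ((((cd.pdeg : ℝ) + 2) * (cd.bb j * m * u) ^ (cd.pdeg + 1) -
      ((cd.pdeg : ℝ) + 1) * (cd.bb j * m * u) ^ (cd.pdeg + 2)) / (1 - cd.bb j * m * u) ^ 2 +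
      (1 / (1 - cd.bb j * (m + ρ) * u) ^ 2 - 1 / (1 - cd.bb j * m * u) ^ 2)) with hB
  set Vc : ℝ := ∑ n ∈ Finset.range (cd.pdeg + 1), varJet (Qw cd) (toVec cd x) (toVec cd (y - y')) n c * u ^ n
    with hVc
  have hL : ∀ σ ∈ Icc (0:ℝ) 1, ∃ L : (Fin (nW cd) → ℝ) →L[ℝ] (Fin (nW cd) → ℝ),
      HasFDerivAt (fun w => Φ w u) L (toVec cd y' + σ • toVec cd (y - y')) ∧
      |L (toVec cd (y - y')) c - Vc| ≤ B * wW cd j c := by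
    intro σ hσ
    have hv := (inBall_iff_toVec cd j _ ρ).1 (hvσ σ hσ)
    obtain ⟨L, hL1, -, hL3⟩ := (key (toVec cd (y' + σ • (y - y') - x)) ρ hρO hv hgO).2.2.2 u hu
    have hpt : toVec cd x + toVec cd (y' + σ • (y - y') - x) = toVec cd y' + σ • toVec cd (y - y') := by
      simp only [toVec_add, toVec_sub, toVec_smul]; abel
    rw [hpt] at hL1
    refine ⟨L, hL1, ?_⟩
    have hw : ∀ c', |toVec cd (y - y') c'| ≤ dd * wW cd j c' := (inBall_iff_toVec cd j _ dd).1 hyy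
    have h := hL3 (toVec cd (y - y')) dd cd.pdeg hdd hw c
    rw [hVc, hB]
    exact h
  -- the auxiliary function along the segment and its derivative
  set g : ℝ → ℝ := fun σ => Φ (toVec cd y' + σ • toVec cd (y - y')) u c - σ * Vc with hg
  set f' : ℝ → ℝ := fun σ =>
    if h : σ ∈ Icc (0:ℝ) 1 then (Classical.choose (hL σ h)) (toVec cd (y - y')) c - Vc else 0 with hf'
  have hgder : ∀ σ ∈ Icc (0:ℝ) 1, HasDerivWithinAt g (f' σ) (Icc 0 1) σ := by
    intro σ hσ
    obtain ⟨hF, -⟩ := Classical.choose_spec (hL σ hσ)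
    have hg' : HasDerivAt (fun σ' : ℝ => toVec cd y' + σ' • toVec cd (y - y')) (toVec cd (y - y')) σ := by
      simpa using ((hasDerivAt_id σ).smul_const (toVec cd (y - y'))).const_add (toVec cd y')
    have hcomp := (hasDerivAt_pi.1 (hF.comp_hasDerivAt σ hg')) c
    have hlin : HasDerivAt (fun σ' : ℝ => σ' * Vc) Vc σ := by
      simpa using (hasDerivAt_id σ).mul_const Vc
    have h := (hcomp.sub hlin).hasDerivWithinAt (s := Icc 0 1)
    simp only [hf', dif_pos hσ]
    exact h
  have hbound : ∀ σ ∈ Ico (0:ℝ) 1, ‖f' σ‖ ≤ B * wW cd j c := by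
    intro σ hσ
    have hσ' : σ ∈ Icc (0:ℝ) 1 := Ico_subset_Icc_self hσ
    obtain ⟨-, hB'⟩ := Classical.choose_spec (hL σ hσ')
    simp only [hf', dif_pos hσ', Real.norm_eq_abs]
    exact hB'
  have hmvt := norm_image_sub_le_of_norm_deriv_le_segment' hgder hbound 1 (right_mem_Icc.2 zero_le_one)
  rw [Real.norm_eq_abs, sub_zero, mul_one] at hmvt
  -- unfold `g 1 - g 0` into the claimed component
  have e1 : g 1 - g 0 = Φ (toVec cd y) u c - Φ (toVec cd y') u c - Vc := by
    simp only [hg, one_smul, zero_smul, add_zero, one_mul, zero_mul, sub_zero]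
    have : toVec cd y' + toVec cd (y - y') = toVec cd y := by simp only [toVec_sub]; abel
    rw [this]; ring
  rw [e1] at hmvt
  rw [toVec_sub, toVec_sub, stAt_liftFlow, stAt_liftFlow, toVec_ofVec, toVec_ofVec, Pi.sub_apply, Pi.sub_apply,
    toVec_Vap (hWj (y - y')) u c, ← hVc]
  refine hmvt.trans (le_of_eq ?_)
  simp only [hB, CertData.RemV]
  ring

end Pack

end Summit.NavierStokesRegularity.NavierStokesRegularity.Theorems.TaylorModelReadout

end
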